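import Mathlib

/-!
# Split-rank-one terms of order `4`, their contractions and the pencil — definitions
# (crux `RankRigidMinimalRepr`, stmt-ValiantsHypothesis-18034, route `RigidityForcesSymmetry`)

Vocabulary for the exact analysis of `LaplaceOptimal 4` (`…RankRigidMinimalReprLaplaceDefs.lean`: every split-rank-one
expression of the permutation pattern `[v : Fin 4 → Fin 4 injective]` has Laplace weight `Σ |S_t|!(4-|S_t|)! ≥ 24`).
Tensors of order `4` over `ℂ⁴` are handled as functions `(Fin 4 → Fin 4) → ℂ` of the four letter-values `v 0, …, v 3`
(the format of `LaplaceOptimal`):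

* `permPattern₄` — the pattern itself;
* `DependsOnlyOn S f` — `f v` depends only on `v|_S`;  `IsSplitTerm S X` — `X = u · w` with `u` depending on `v|_S`
  and `w` on `v|_{Sᶜ}` (a term of `LaplaceOptimal 4` across `S`; for `|S| = 1, 3` a SLICE, for `|S| = 2` a PAIR term on
  the matching `{S | Sᶜ}`);  `IsSumOf p n X` — `X` is a sum of `n` tensors each satisfying `p` (zero terms allowed);
* `slotPerm σ X` — relabelling the four slots (`P₄` is invariant, a term across `S` goes to a term across `σ⁻¹(S)`);
* `contract₀₁ X ψ φ` — the `4 × 4` matrix in the slots `2, 3` obtained by pairing slot `0` with `ψ` and slot `1` with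
  `φ` (multilinear extension); for `X = permPattern₄` this is the symmetric zero-diagonal matrix
  `Q_{ψ,φ}(z,w) = ψ_xφ_y + ψ_yφ_x` (`{x,y} = {z,w}ᶜ`), and `Q_{t,𝟙}` is
* `pencil t` — `M(t)(z,w) = [z ≠ w](Σt - t_z - t_w)`, whose rank-`≤ 2` locus is ten lines
  (`…LaplaceFourPencil.lean`).

Definitions only (reviewed); the theorems live in `…LaplaceFour*.lean`.  HONEST FRAMING: bookkeeping toward the finite
statement `LaplaceOptimal 4` (rung `TiedTorusBound 3`); nothing here bears on the crux or on `VP ≠ VNP`.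
-/

set_option autoImplicit false

-- the mandated summit-side namespace repeats a component by design (single-problem summit)
set_option linter.dupNamespace false

namespace Summit.ValiantsHypothesis.ValiantsHypothesis.Theorems.RigidityForcesSymmetryRankRigidMinimalRepr

/-- The permutation pattern of order `4` as a tensor: `P₄(v) = [v injective]` for `v : Fin 4 → Fin 4`
(the coefficient tensor of `perm₄`; the right-hand side of `LaplaceOptimal 4`). -/
noncomputable def permPattern₄ (v : Fin 4 → Fin 4) : ℂ := if Function.Injective v then 1 else 0

/-- `f v` depends only on the values `v i`, `i ∈ S` (the dependence format of `LaplaceOptimal`). -/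
def DependsOnlyOn (S : Finset (Fin 4)) (f : (Fin 4 → Fin 4) → ℂ) : Prop :=
  ∀ v v' : Fin 4 → Fin 4, (∀ i ∈ S, v i = v' i) → f v = f v'

/-- A SPLIT-RANK-ONE TERM across `S | Sᶜ`: `X(v) = u(v|_S) · w(v|_{Sᶜ})`.  For `S = {i}` or `S = {i}ᶜ` this is a slice
along slot `i`; for `|S| = 2` a pair term on the matching `{S | Sᶜ}` of the four slots. -/
def IsSplitTerm (S : Finset (Fin 4)) (X : (Fin 4 → Fin 4) → ℂ) : Prop :=
  ∃ u w : (Fin 4 → Fin 4) → ℂ, DependsOnlyOn S u ∧ DependsOnlyOn Sᶜ w ∧ ∀ v, X v = u v * w v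

/-- `X` is a sum of `n` tensors each satisfying `p` (the zero tensor is a split term, so «at most `n`» is the same). -/
def IsSumOf (p : ((Fin 4 → Fin 4) → ℂ) → Prop) (n : ℕ) (X : (Fin 4 → Fin 4) → ℂ) : Prop :=
  ∃ Y : Fin n → (Fin 4 → Fin 4) → ℂ, (∀ k, p (Y k)) ∧ ∀ v, X v = ∑ k, Y k v

/-- Relabelling the slots by `σ`: `(slotPerm σ X)(v) = X(v ∘ σ)`.  The pattern is invariant and a split term across `S`
becomes a split term across `σ⁻¹(S)` (`…LaplaceFourContraction.lean`). -/
def slotPerm (σ : Equiv.Perm (Fin 4)) (X : (Fin 4 → Fin 4) → ℂ) : (Fin 4 → Fin 4) → ℂ := fun v => X (v ∘ σ)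

/-- CONTRACTION of slots `0, 1` against `ψ, φ ∈ ℂ⁴` (multilinear extension in the letter basis), leaving the `4 × 4`
matrix of the slots `2, 3`: `(contract₀₁ X ψ φ)(z,w) = Σ_{x,y} ψ_x φ_y X(x,y,z,w)`. -/
noncomputable def contract₀₁ (X : (Fin 4 → Fin 4) → ℂ) (ψ φ : Fin 4 → ℂ) : Matrix (Fin 4) (Fin 4) ℂ :=
  Matrix.of fun z w => ∑ x, ∑ y, ψ x * φ y * X ![x, y, z, w]

/-- The PENCIL matrix `M(t)(z,w) = [z ≠ w](T - t_z - t_w)`, `T = Σ t`: the contraction `contract₀₁ permPattern₄ t 𝟙`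
(and, up to diagonal scaling, `contract₀₁ permPattern₄ (φ∘t) φ` for `φ ∈ (ℂˣ)⁴`). -/
noncomputable def pencil (t : Fin 4 → ℂ) : Matrix (Fin 4) (Fin 4) ℂ :=
  Matrix.of fun z w => if z = w then 0 else (∑ i, t i) - t z - t w

end Summit.ValiantsHypothesis.ValiantsHypothesis.Theorems.RigidityForcesSymmetryRankRigidMinimalRepr
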